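import Summits.QuantumFields.YangMills.Theorems.UnitScaleTiltProp7StubEXOfChartPiecesTwS33L
import Summits.QuantumFields.YangMills.Theorems.UnitScaleTiltProp7NumericWindowsInhabitedS31C
import HarnessLib

/-!
# «NUMERALS OUT» — THE EX DISPLAY WITH ITS 29 NUMERIC BINDERS AND 8 CENSUS LETTERS DISCHARGED BY KERNEL (PARALLEL DOOR, NOT OF RECORD — EX namer ym-ust-19200-w2 g9 2026-08-29T11:21:58Z,
# ★★OWNER g30 11:30:14Z (2); door over the display of record S33ᴸ ✓p712567 (94 binders; first cuts over S31ᴸ ✓p703595 ∕ S32ᴸ ✓p709167 by px14 g4); width seat px14 g5, 2026-08-29)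
# Route `UnitScaleTilt`, crux «MinimiserStabilityRegPr» (stmt-QuantumFields-19200), stub `stub_existenceMinimalOrbit` (EX), route (α).  Cell `ym3-torus`.  THEOREMS ONLY (0 `def`, 0 `sorry`);
# `--supports stmt-QuantumFields-19200 --as helper`; count-neutral.  YM₃ on T³ is a ladder rung (R3), NOT the Clay problem; nothing here claims the stub, the crux, d = 4 or the mass gap.
#
# WHAT IT DOES.  S33ᴸ's hypotheses VERBATIM except: (i) the census letters `C₄ a₃ α r M εC ef ε′` and their positivity `hC₄ ha₃ hα hr hM hef`, and ALL 23 L-only windows + `hεC`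
# (`hWQ hWe hWε hWe'' hWε'' hMe hw137 hq47 hR6 hrε2 hεC hdomC hselfC hcontrC hrα hr4 hr16 hqΘ hR16 hC4 hMdoor hWe2 hWε2`) are GONE — produced inside by ✓`numericWindows_inhabited_family_S31C`
# (px14 g4 ✓p704177: census v5 at the S31ᴸ letters, 43∕43 binders verbatim + `hαcap`); (ii) ONE new letter `(ecap : ℕ → ℝ) (hecap : ∀ L>1, 0 < ecap L)` — the common regularity threshold of the
# suppliers; (iii) the THIRTEEN analytic rows that were stated AT the census letter `α` are re-stated in SUPPLIER SHAPE, i.e. for every regularity radius below the threshold: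
# in `hPos₁ hPosπ hPosΔ h133 h88 h137kπ hPcol hCk h137kΔ h349` the prefix `RegPr … (α L) U₀ →` reads `∀ ρ : ℝ, RegPr … ρ U₀ → ρ ≤ ecap L →`, and in `norm_G norm_H₁ norm_Hπ` the guard
# `ρ ≤ α L` reads `ρ ≤ ecap L` (print's own shape: «for ρ ≤ e₀(L) and every ρ-regular U₀ …», [Balaban1985BackgroundPropagators] Thm 3.3 p.399, Thm 3.12 (3.133) p.422); every other row
# (`c₀ cB a ha`, the sign letters `B₀ CH δH CΔ δΔ p139 C349 … δC`, `a₀ ha₀`, the lane-II rows `hEng hB2a H hH0 hQH1 hPatch`, the labelled route rows `hMc hMc₂ hN2s`, `hThm2S`) and the conclusion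
# (= the registered `stub_existenceMinimalOrbit` text) byte-identical.
# PROOF.  `obtain ⟨ef, α, …, hαcap, hC4, hMdoor⟩ := numericWindows_inhabited_family_S31C … ecap hecap`, then `exact stubEX_of_chartPiecesTwS33L …` with each of the 13 rows restricted from
# `ρ ≤ ecap L` to the census's `α L ≤ ecap L` (`hαcap`).  Binder count: S33ᴸ's 94 explicit names − 37 + 2 = 59 (the numerals census of record ✓p704177 covers S33ᴸ 43∕43: px14 g5 11:17:46Z).
# STATUS (namer∕owner words above): a PARALLEL door — the display of record stays the Sᴸ chain with the numerals displayed and discharged ONCE at the end by the census theorem;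
# this file certifies by kernel that the 37 displayed windows∕signs are JOINTLY INHABITABLE and shows the end-game shape; it becomes the of-record knit only if the N06 pens adopt the
# `ρ ≤ ecap` supplier shape (one S-event, namer's call).
# HONEST SCOPE: a by-name knit + arithmetic; no analytic row is proved here; the thirteen rows, the lane-II rows, `hMc hMc₂ hN2s`, `hThm2S` stay displayed (supplier-shaped); CONDITIONAL — the stub
# is not closed.
-/

set_option autoImplicit false

noncomputable section

open scoped BigOperators Matrix.Norms.L2Operator Matrix InnerProductSpace

namespace Summit.QuantumFields.YangMills.Theorems.Prop7StubEXNumeralsOut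

open NormedSpace
open Literature.Analysis.Calculus.ExpDifferential (ad gSer)
open Literature.MathematicalPhysics.QuantumFieldTheory.Balaban1983to89
open Literature.MathematicalPhysics.QuantumFieldTheory.Balaban1983to89.T3ContinuumYM3Torus
open Literature.MathematicalPhysics.QuantumFieldTheory.Balaban1983to89.T3UnitLawDensityEML (ℰp)
open Literature.MathematicalPhysics.QuantumFieldTheory.Balaban1983to89.T3TiltDescent (descendTo)
open Literature.MathematicalPhysics.QuantumFieldTheory.Balaban1983to89.T3ConstrainedMinimiser (fibre)
open Literature.MathematicalPhysics.QuantumFieldTheory.Balaban1983to89.T3PrintedRegularMinimiser (RegPr regFibrePr)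
open Literature.MathematicalPhysics.QuantumFieldTheory.Balaban1983to89.T3Thm1Carrier
open Literature.MathematicalPhysics.QuantumFieldTheory.Balaban1983to89.T3SectALandauChart (In19 emb15 CloseAvg eta bgUnits pert)
open B9SectCLatticeCarrier (Bond)
open B9Eq311L2Pairing (WL2)
open B10Eq27TorusAxialLog (unitsField toUField pull transl holT)
open B11Eq115Space (NegSup NegSize Space115 JetSup levWeight)
open B11Eq111FrakG (nabla115)
open B11Eq98CurrentSlot (Jcur)
open B11Eq103H1Complex (BondL2K funEquiv SiteL2K laplaceAK)
open B11Prop3Model (Dfix)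
open B13Contraction113 (QuadAnalytic)
open B8Thm2SetupTorus (Thm2SetupSUAt)
open MatrixLog (mlog)
open Summit.QuantumFields.YangMills.Theorems.Prop7TPrint (nMax19 expHermField)
open Summit.QuantumFields.YangMills.Theorems.Prop7SPrint (NormS IsLandauPrintS basePt RestrictedPrint isLandauPrintS_iff_RS AvgCondPrint IsLandauPrint)
open Summit.QuantumFields.YangMills.Theorems.Prop7SectET3Transport (periodsT3 bgOfCfg bondEquiv)
open Summit.QuantumFields.YangMills.Theorems.Prop7SectET3HilbertLetters (W₂ toL2 toL2B DL2 DstarL2 frobEquiv covLapSite toL2S)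
open Summit.QuantumFields.YangMills.Theorems.Prop7SectET3GaugeProjector (RS)
open Summit.QuantumFields.YangMills.Theorems.Prop7SymAvgTwSym (QTwS CmapTwS Chart47T3twS)
open Summit.QuantumFields.YangMills.Theorems.Prop7SymAvgGL (QSym descendToGL)
open Summit.QuantumFields.YangMills.Theorems.Prop7SectET3CurvedPropagators (laplaceA PosOnto frakGfR H1f QTwS_Hf Qk GT KinvT)
open Summit.QuantumFields.YangMills.Theorems.Prop7SectET3DeltaPiPInv (DeltaPiSlotP H46P inner_DL2_DeltaPiP_eq_zero GprimeP)
open Summit.QuantumFields.YangMills.Theorems.Prop7SectET3DeltaOnePInv (DeltaOnePJ TJSlotP DeltaOneP_kills_NS inner_DL2_DeltaOneP_eq_zero)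
open Summit.QuantumFields.YangMills.Theorems.Prop7StubEXOfChartPiecesTwS9PCtrDL (stubEX_of_chartPiecesTwS9PCtrDL)
open Summit.QuantumFields.YangMills.Theorems.Prop7HDsolAtRecordOfRowsTwoSlotFamilyL (hΔsol_of_opRows_twoSlot_familyL)
open Summit.QuantumFields.YangMills.Theorems.Prop7HWROfRowsFamily (hWR_of_rows_family)
open Summit.QuantumFields.YangMills.Theorems.Prop7Prop4OfW80RowsAtRecord (prop4_W80_family)
open Summit.QuantumFields.YangMills.Theorems.Prop7DeltaEtaHfCompositeNorm (hN₁_family_of_rows)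
open Summit.QuantumFields.YangMills.Theorems.Prop7RieszTauFrobNorm (opNorm_rieszτ_frobEquiv_le_one opNorm_trace_clm_le_two hqV_record_family)
open Summit.QuantumFields.YangMills.Theorems.Prop7V0CurrentReality (hV0_of_RC_family)
open Summit.QuantumFields.YangMills.Theorems.Prop7ThetaOfColumnLettersT3 (theta_rows_family_of_columnLetters)
open Summit.QuantumFields.YangMills.Theorems.Prop7RCOfRowsFamily (hRC_of_rows_family_B₀)
open Summit.QuantumFields.YangMills.Theorems.Prop7RealityRowsFamily (hHfR_family hH₁R_family h𝒢R_family)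
open B11Eq63V0GroupCurrent (curV0)
open B11Eq80Current (Emap E3 W80)
open B11Eq90Transpose (kernel single115)
open B11Eq90V0primeCurrent (flat115)
open B11Eq174Chart (Regime)
open B11Eq90V0GroupComposed (curV0full T47)
open Summit.QuantumFields.YangMills.Theorems.Prop7SectET3EXJunction (h102_of_posOnto h129_of_posOnto h45_of_posOnto h102LS_of_posOnto h129LS_of_posOnto)
open Summit.QuantumFields.YangMills.Theorems.Prop7H46GradRow (h46_rows_of_norm115)
open Summit.QuantumFields.YangMills.Theorems.Prop7QkOntoOfRegPr (surjective_Qk_of_regPr)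
open T3SectALandauChart (bgUnits covGradT covCodiffCurlT covLapFormT)

open Summit.QuantumFields.YangMills.Theorems.Prop7SectET3WilsonHessian (DeltaEta DeltaEtaSlot)
open Summit.QuantumFields.YangMills.Theorems.Prop7H46TwoOfOpRowsFamily (hBH₂_of_nonneg)
open Summit.QuantumFields.YangMills.Theorems.Prop7HDsolAtRecordOfRowsFamily (hMΔ_of_nonneg)
open Summit.QuantumFields.YangMills.Theorems.Prop7H46PTwoOfOpRowsFamily (h46₂P_of_opRows_family)

open B11Eq98V0primeCurrentSlots (rieszτ)
open B9Eq3119DeltaPiCarrier (currentCLM)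
open Summit.QuantumFields.YangMills.Theorems.Prop7ColumnRowsOfKernelDecay (hHcol_of_kernel133_family hΔHcol_of_kernel88_family thetaH_nonneg thetaΔ_nonneg)
open Summit.QuantumFields.YangMills.Theorems.Prop7Op349OfKernelRow (hOp349_of_kernel349_family k349_nonneg)
open Summit.QuantumFields.YangMills.Theorems.Prop7PA2OfSymDiffDivRows (hPA2_of_symL1_diffL1_divSlice)
open Summit.QuantumFields.YangMills.Theorems.Prop7DivSliceRowHolds (hV_holds)
open Summit.QuantumFields.YangMills.Theorems.Prop7HcoSOfNormG0DiffRow (hS_holds)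
open Summit.QuantumFields.YangMills.Theorems.Prop7StubEXOfChartPiecesTwS32L (stubEX_of_chartPiecesTwS32L)
open Summit.QuantumFields.YangMills.Theorems.Prop7HcoOfDivRecovery (hN06_of_divRecovery)
open Summit.QuantumFields.YangMills.Theorems.Prop7DivRecoveryOfCollected (hRec_of_collected)
open Summit.QuantumFields.YangMills.Theorems.Prop7DivRecoveryCollectedOfRows (hColl_of_rows)
open Summit.QuantumFields.YangMills.Theorems.Prop7DivRecoveryPatchesToRows (hRows_of_core_and_patches)
open Summit.QuantumFields.YangMills.Theorems.Prop7DivRecoveryMemberCorePackaged (member_core_row_packaged)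
open Summit.QuantumFields.YangMills.Theorems.Prop7DivRecoveryCoarseRows (coarse_rows)
open Literature.MathematicalPhysics.QuantumLattice (blockBase)
open T3LevelShift (bondShift siteShift)
open B7Eq78Linearization (conjR)
open B7Prop1Explicit (U1 expUnit)
open T4TermwiseTorus (tlift)
open Summit.QuantumFields.YangMills.Theorems.Prop7QprimeCombL2 (QprimeCombL2 RcombL2)
open B7Eq92Concrete (tildIter)
open BlockAveragingEMLLinearisedBackground (pertVar)
open ExpMeanLog (expMeanLogSU)
open BlockAveraging (blockAvg)
open Summit.QuantumFields.YangMills.Theorems.Prop7CovKernel157Family (hC157_family)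
open B9Eq39Adjoint (divB)
open B9TorusCalculus (torusT)
open Summit.QuantumFields.YangMills.Theorems.Prop7SectET3CombLetters (Qkc)
open Summit.QuantumFields.YangMills.Theorems.Prop7SymAvgTw (CmapTw)
open Summit.QuantumFields.YangMills.Theorems.Prop7CcolOf157Entry (hCcol_of_157_family hG0_of_hg0)
open Prop8Chart (emlIterU)
open B15DeterminingSets (embIter)
open Summit.QuantumFields.YangMills.Theorems.Prop7Op137OfKernelRows (h137π_of_kernel137_family h137Δ_of_kernel137_family hOpC_of_kernelC_family)
open B5Eq118OneStroke (iterBlockOf)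
open T3PrintedRegularOrbits (sites_eq)
variable {L : ℕ}
open Summit.QuantumFields.YangMills.Theorems.Prop7StubEXOfChartPiecesTwS33L (stubEX_of_chartPiecesTwS33L)
open Summit.QuantumFields.YangMills.Theorems.Prop7NumericWindowsInhabited (numericWindows_inhabited_family_S31C)

set_option maxHeartbeats 400000 in
-- HEARTBEAT rule (README): the census `obtain` (38 names) + the 94-argument `exact` with 13 η-expanded adapters; budget at the chain's measured margin; decl-local (≤ 400k, unworded class).
/-- («NUMERALS OUT», px14 g4∕g5 2026-08-29; PARALLEL DOOR, NOT OF RECORD — EX namer w2 g9 11:21:58Z, ★★OWNER g30 11:30:14Z.) ★★★ The EX display of record S33ᴸ with its 29 numeric binders and 8 census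
letters DISCHARGED (census ✓`numericWindows_inhabited_family_S31C` inside) and its thirteen `α`-rows re-stated at an arbitrary supplier threshold `ecap` (module docstring (i)–(iii)); conclusion =
`stub_existenceMinimalOrbit`'s registered text VERBATIM.  ★★OWNER g29 2026-08-29T07:25:55Z condition (a): `ecap` is ONE common threshold letter for all ten `RegPr` rows and the three norm rows —
suppliers with different regularity thresholds `e₀ᵢ(L)` (print: «for ρ ≤ e₀(L) and every ρ-regular U₀») MEET AT THE MINIMUM: the knit takes `ecap L := min (e₀₁ L) (min (e₀₂ L) …)` (`hecap` by `lt_min`)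
and restricts each supplier's row by `min_le_…`; condition (b): suppliers of `h133 h88 h349 h137kπ hCk h137kΔ hPcol hPos₁ hPosπ hPosΔ norm_G norm_H₁ norm_Hπ` type the shape `∀ ρ ≤ e₀(L)` (a row at
the single value `α L` no longer fits).  CONDITIONAL — the stub is not closed.
[cite: Balaban1985Variational, Prop. 7 p.299, (141)-(142) p.299, Prop. 4 (97)–(98) pp.292–293, (118)–(121) p.295, (136)–(140) pp.298–299; Balaban1985BackgroundPropagators, Thm 3.3 p.399, Thm 3.11 p.416, Thm 3.12 (3.133) p.422] -/
theorem stubEX_of_rows_numeralsOut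
    [hFL : ∀ F : T3Family, Fact (0 < (F.L : ℝ))]
    [hFη : ∀ (F : T3Family) (k : ℕ), Fact (0 < ((F.L : ℝ)⁻¹) ^ k)]
    (B₀ : ℕ → ℝ)
    (hB₀ : ∀ L, 1 < L → 0 < B₀ L)
    -- (NUMERALS OUT) the ONE regularity threshold below which every supplier's row is asked; the census letter `α ≤ ecap` and all 29 numerals are chosen INSIDE the proof
    (ecap : ℕ → ℝ) (hecap : ∀ L : ℕ, 1 < L → 0 < ecap L)
    (c₀ cB : ℕ → ℝ)
    [hc₀ : ∀ L : ℕ, Fact (0 < c₀ L)]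
    [hcB : ∀ L : ℕ, Fact (0 < cB L)]
    (a : ∀ L : ℕ, Idx L → ℝ)
    (ha : ∀ (L : ℕ) (i : Idx L), 0 < a L i)
    (hPos₁ : ∀ (L : ℕ), 1 < L → ∀ (i : Idx L) (U₀ : GaugeField (i.1.1.P i.1.2.2) 0 (Matrix.specialUnitaryGroup (Fin 2) ℂ)), ∀ ρ : ℝ, RegPr i.1.1 i.1.2.1 i.1.2.2 ρ U₀ → ρ ≤ ecap L →
      ∀ x : BondL2K ℂ 3 (periodsT3 i.1.1 i.1.2.2) (c₀ L) W₂, x ≠ 0 →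
        0 < RCLike.re ⟪x, laplaceA i.1.1 i.1.2.1 i.1.2.2 i.2.2.le (c₀ L) (cB L) (a L i) (DeltaOnePJ i.1.1 i.1.2.1 i.1.2.2 i.2.2.le (c₀ L) (cB L) (a L i)) U₀ x⟫_ℂ)
    (hPosπ : ∀ (L : ℕ), 1 < L → ∀ (i : Idx L) (U₀ : GaugeField (i.1.1.P i.1.2.2) 0 (Matrix.specialUnitaryGroup (Fin 2) ℂ)), ∀ ρ : ℝ, RegPr i.1.1 i.1.2.1 i.1.2.2 ρ U₀ → ρ ≤ ecap L →
      ∀ x : BondL2K ℂ 3 (periodsT3 i.1.1 i.1.2.2) (c₀ L) W₂, x ≠ 0 →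
        0 < RCLike.re ⟪x, laplaceA i.1.1 i.1.2.1 i.1.2.2 i.2.2.le (c₀ L) (cB L) (a L i) (DeltaPiSlotP i.1.1 i.1.2.1 i.1.2.2 i.2.2.le (c₀ L) (cB L) (a L i)) U₀ x⟫_ℂ)
    (hPosΔ : ∀ (L : ℕ), 1 < L → ∀ (i : Idx L) (U₀ : GaugeField (i.1.1.P i.1.2.2) 0 (Matrix.specialUnitaryGroup (Fin 2) ℂ)), ∀ ρ : ℝ, RegPr i.1.1 i.1.2.1 i.1.2.2 ρ U₀ → ρ ≤ ecap L →
      ∀ x : BondL2K ℂ 3 (periodsT3 i.1.1 i.1.2.2) (c₀ L) W₂, x ≠ 0 →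
        0 < RCLike.re ⟪x, laplaceA i.1.1 i.1.2.1 i.1.2.2 i.2.2.le (c₀ L) (cB L) (a L i) ((DeltaEtaSlot i.1.1 i.1.2.1 i.1.2.2 (c₀ L) + TJSlotP i.1.1 i.1.2.1 i.1.2.2 i.2.2.le (c₀ L) (cB L) (a L i))) U₀ x⟫_ℂ)
    (norm_G : ∀ (L : ℕ), 1 < L → ∀ (i : Idx L) (ρ : ℝ) (U₀ : GaugeField (i.1.1.P i.1.2.2) 0 (Matrix.specialUnitaryGroup (Fin 2) ℂ)),
      RegPr i.1.1 i.1.2.1 i.1.2.2 ρ U₀ → ρ ≤ ecap L → ∀ f, ‖frakGfR i.1.1 i.1.2.1 i.1.2.2 i.2.2.le (c₀ L) (cB L) (a L i) (DeltaOnePJ i.1.1 i.1.2.1 i.1.2.2 i.2.2.le (c₀ L) (cB L) (a L i)) U₀ f‖ ≤ B₀ L * ‖f‖)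
    (CH δH CΔ δΔ : ℕ → ℝ)
    (hCH : ∀ L, 1 < L → 0 ≤ CH L)
    (hδH : ∀ L, 1 < L → 0 < δH L)
    (hCΔ : ∀ L, 1 < L → 0 ≤ CΔ L)
    (hδΔ : ∀ L, 1 < L → 0 < δΔ L)
    (h133 : ∀ (L : ℕ), 1 < L → ∀ (i : Idx L) (U₀ : GaugeField (i.1.1.P i.1.2.2) 0 (Matrix.specialUnitaryGroup (Fin 2) ℂ)), ∀ ρ : ℝ, RegPr i.1.1 i.1.2.1 i.1.2.2 ρ U₀ → ρ ≤ ecap L →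
      ∀ (y : PBond (i.1.1.P i.1.2.1) 0) (Z : Matrix (Fin 2) (Fin 2) ℂ) (b' : Bond 3 (periodsT3 i.1.1 i.1.2.2)),
        ‖flat115 ((H1f i.1.1 i.1.2.1 i.1.2.2 i.2.2.le (c₀ L) (cB L) (a L i) (DeltaPiSlotP i.1.1 i.1.2.1 i.1.2.2 i.2.2.le (c₀ L) (cB L) (a L i)) U₀) (Pi.single y Z)) b'‖
          ≤ CH L * Real.exp (-(δH L / 2 * (Site.tdist (B5Eq118OneStroke.iterBlockOf (i.1.2.2 - i.1.2.1) ((bondEquiv i.1.1 i.1.2.2).symm b').src) (T3LevelShift.siteShift (T3PrintedRegularOrbits.sites_eq i.1.1 i.1.2.1 i.1.2.2 i.2.2.le) y.src) : ℝ))) * ‖Z‖)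
    (h88 : ∀ (L : ℕ), 1 < L → ∀ (i : Idx L) (U₀ : GaugeField (i.1.1.P i.1.2.2) 0 (Matrix.specialUnitaryGroup (Fin 2) ℂ)), ∀ ρ : ℝ, RegPr i.1.1 i.1.2.1 i.1.2.2 ρ U₀ → ρ ≤ ecap L →
      ∀ (y : PBond (i.1.1.P i.1.2.1) 0) (Z : Matrix (Fin 2) (Fin 2) ℂ) (b' : Bond 3 (periodsT3 i.1.1 i.1.2.2)),
        ‖NegSup.equiv (levWeight (i.1.1.L : ℝ) (((i.1.1.L : ℝ)⁻¹) ^ (i.1.2.2 - i.1.2.1)) (fun _ : Bond 3 (periodsT3 i.1.1 i.1.2.2) => i.1.2.2 - i.1.2.1) 3) (Matrix (Fin 2) (Fin 2) ℂ) ((currentCLM frobEquiv (fun _ : Bond 3 (periodsT3 i.1.1 i.1.2.2) × Fin 3 => i.1.2.2 - i.1.2.1) (nabla115 (((i.1.1.L : ℝ)⁻¹) ^ (i.1.2.2 - i.1.2.1)) (bgOfCfg i.1.1 i.1.2.2 U₀)) (DeltaEtaSlot i.1.1 i.1.2.1 i.1.2.2 (c₀ L) U₀)) ((H1f i.1.1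 i.1.2.1 i.1.2.2 i.2.2.le (c₀ L) (cB L) (a L i) (DeltaPiSlotP i.1.1 i.1.2.1 i.1.2.2 i.2.2.le (c₀ L) (cB L) (a L i)) U₀) (Pi.single y Z))) b'‖
          ≤ CΔ L * Real.exp (-(δΔ L * (Site.tdist (B5Eq118OneStroke.iterBlockOf (i.1.2.2 - i.1.2.1) ((bondEquiv i.1.1 i.1.2.2).symm b').src) (T3LevelShift.siteShift (T3PrintedRegularOrbits.sites_eq i.1.1 i.1.2.1 i.1.2.2 i.2.2.le) y.src) : ℝ))) * ‖Z‖)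
    (norm_H₁ : ∀ (L : ℕ), 1 < L → ∀ (i : Idx L) (ρ : ℝ) (U₀ : GaugeField (i.1.1.P i.1.2.2) 0 (Matrix.specialUnitaryGroup (Fin 2) ℂ)),
      RegPr i.1.1 i.1.2.1 i.1.2.2 ρ U₀ → ρ ≤ ecap L → ∀ b, ‖H1f i.1.1 i.1.2.1 i.1.2.2 i.2.2.le (c₀ L) (cB L) (a L i) (DeltaOnePJ i.1.1 i.1.2.1 i.1.2.2 i.2.2.le (c₀ L) (cB L) (a L i)) U₀ b‖ ≤ B₀ L * ‖b‖)
    (norm_Hπ : ∀ (L : ℕ), 1 < L → ∀ (i : Idx L) (ρ : ℝ) (U₀ : GaugeField (i.1.1.P i.1.2.2) 0 (Matrix.specialUnitaryGroup (Fin 2) ℂ)),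
      RegPr i.1.1 i.1.2.1 i.1.2.2 ρ U₀ → ρ ≤ ecap L → ∀ b, ‖H1f i.1.1 i.1.2.1 i.1.2.2 i.2.2.le (c₀ L) (cB L) (a L i) (DeltaPiSlotP i.1.1 i.1.2.1 i.1.2.2 i.2.2.le (c₀ L) (cB L) (a L i)) U₀ b‖ ≤ B₀ L * ‖b‖)
    (p139 : ℕ → ℝ)
    (hp139 : ∀ L : ℕ, 1 < L → 0 ≤ p139 L)
    (C349 δ349 CKπ δKπ CKΔ δKΔ CC δC : ℕ → ℝ)
    (hC349 : ∀ L, 1 < L → 0 ≤ C349 L)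
    (hδ349 : ∀ L, 1 < L → 0 < δ349 L)
    (hCKπ : ∀ L, 1 < L → 0 ≤ CKπ L)
    (hδKπ : ∀ L, 1 < L → 0 < δKπ L)
    (hCKΔ : ∀ L, 1 < L → 0 ≤ CKΔ L)
    (hδKΔ : ∀ L, 1 < L → 0 < δKΔ L)
    (hCC : ∀ L, 1 < L → 0 ≤ CC L)
    (hδC : ∀ L, 1 < L → 0 < δC L)
    (h137kπ : ∀ (L : ℕ), 1 < L → ∀ (i : Idx L) (U₀ : GaugeField (i.1.1.P i.1.2.2) 0 (Matrix.specialUnitaryGroup (Fin 2) ℂ)), ∀ ρ : ℝ, RegPr i.1.1 i.1.2.1 i.1.2.2 ρ U₀ → ρ ≤ ecap L →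
      ∀ (y : PBond (i.1.1.P i.1.2.1) 0) (Z : Matrix (Fin 2) (Fin 2) ℂ) (b : PBond (i.1.1.P i.1.2.2) 0),
        ‖(toL2 i.1.1 i.1.2.2 (c₀ L)).symm (LinearMap.adjoint (Qk i.1.1 i.1.2.1 i.1.2.2 i.2.2.le (c₀ L) (cB L) U₀) (KinvT i.1.1 i.1.2.1 i.1.2.2 i.2.2.le (c₀ L) (cB L) (a L i) (DeltaPiSlotP i.1.1 i.1.2.1 i.1.2.2 i.2.2.le (c₀ L) (cB L) (a L i)) U₀ (toL2B i.1.1 i.1.2.1 (cB L) (Pi.single y Z)))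
            - LinearMap.adjoint (Qk i.1.1 i.1.2.1 i.1.2.2 i.2.2.le (c₀ L) (cB L) U₀) (((a L i : ℂ)) • toL2B i.1.1 i.1.2.1 (cB L) (Pi.single y Z))) b‖
          ≤ CKπ L * Real.exp (-(δKπ L * (Site.tdist (iterBlockOf (i.1.2.2 - i.1.2.1) b.src) (siteShift (sites_eq i.1.1 i.1.2.1 i.1.2.2 i.2.2.le) y.src) : ℝ))) * ‖Z‖)
    (hPcol : ∀ (L : ℕ), 1 < L → ∀ (i : Idx L) (U₀ : GaugeField (i.1.1.P i.1.2.2) 0 (Matrix.specialUnitaryGroup (Fin 2) ℂ)), ∀ ρ : ℝ, RegPr i.1.1 i.1.2.1 i.1.2.2 ρ U₀ → ρ ≤ ecap L →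
      ∀ (bd : PBond (i.1.1.P i.1.2.2) 0) (E : Matrix (Fin 2) (Fin 2) ℂ),
        ∑ x : Site (i.1.1.P i.1.2.2) 0, ‖(toL2S i.1.1 i.1.2.2 (c₀ L)).symm (GprimeP i.1.1 i.1.2.1 i.1.2.2 i.2.2.le (c₀ L) (cB L) (a L i) U₀
          (RS i.1.1 i.1.2.1 i.1.2.2 i.2.2.le (c₀ L) (cB L) U₀ (DstarL2 i.1.1 i.1.2.1 i.1.2.2 (c₀ L) U₀ (toL2 i.1.1 i.1.2.2 (c₀ L) (Pi.single bd E))))) x‖ ≤ p139 L * ‖E‖)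
    (hCk : ∀ (L : ℕ), 1 < L → ∀ (i : Idx L) (U₀ : GaugeField (i.1.1.P i.1.2.2) 0 (Matrix.specialUnitaryGroup (Fin 2) ℂ)), ∀ ρ : ℝ, RegPr i.1.1 i.1.2.1 i.1.2.2 ρ U₀ → ρ ≤ ecap L →
      ∀ (b : PBond (i.1.1.P i.1.2.2) 0) (Z : Matrix (Fin 2) (Fin 2) ℂ) (bd : PBond (i.1.1.P i.1.2.2) 0),
        ‖(toL2 i.1.1 i.1.2.2 (c₀ L)).symm (LinearMap.adjoint (Qk i.1.1 i.1.2.1 i.1.2.2 i.2.2.le (c₀ L) (cB L) U₀) (KinvT i.1.1 i.1.2.1 i.1.2.2 i.2.2.le (c₀ L) (cB L) (a L i) ((DeltaEtaSlot i.1.1 i.1.2.1 i.1.2.2 (c₀ L) + TJSlotP i.1.1 i.1.2.1 i.1.2.2 i.2.2.le (c₀ L) (cB L) (a L i))) U₀ (Qk i.1.1 i.1.2.1 i.1.2.2 i.2.2.le (c₀ L) (cB L) U₀ (GT i.1.1 i.1.2.1 i.1.2.2 i.2.2.le (c₀ L) (cB L) (a L i) ((DeltaEtaSlot i.1.1 i.1.2.1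 i.1.2.2 (c₀ L) + TJSlotP i.1.1 i.1.2.1 i.1.2.2 i.2.2.le (c₀ L) (cB L) (a L i))) U₀ (toL2 i.1.1 i.1.2.2 (c₀ L) (Pi.single b Z)))))) bd‖
          ≤ CC L * ((L : ℝ) ^ (i.1.2.2 - i.1.2.1))⁻¹ ^ 3 * Real.exp (-(δC L * (Site.tdist (iterBlockOf (i.1.2.2 - i.1.2.1) b.src) (iterBlockOf (i.1.2.2 - i.1.2.1) bd.src) : ℝ))) * ‖Z‖)
    (h137kΔ : ∀ (L : ℕ), 1 < L → ∀ (i : Idx L) (U₀ : GaugeField (i.1.1.P i.1.2.2) 0 (Matrix.specialUnitaryGroup (Fin 2) ℂ)), ∀ ρ : ℝ, RegPr i.1.1 i.1.2.1 i.1.2.2 ρ U₀ → ρ ≤ ecap L →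
      ∀ (y : PBond (i.1.1.P i.1.2.1) 0) (Z : Matrix (Fin 2) (Fin 2) ℂ) (b : PBond (i.1.1.P i.1.2.2) 0),
        ‖(toL2 i.1.1 i.1.2.2 (c₀ L)).symm (LinearMap.adjoint (Qk i.1.1 i.1.2.1 i.1.2.2 i.2.2.le (c₀ L) (cB L) U₀) (KinvT i.1.1 i.1.2.1 i.1.2.2 i.2.2.le (c₀ L) (cB L) (a L i) ((DeltaEtaSlot i.1.1 i.1.2.1 i.1.2.2 (c₀ L) + TJSlotP i.1.1 i.1.2.1 i.1.2.2 i.2.2.le (c₀ L) (cB L) (a L i))) U₀ (toL2B i.1.1 i.1.2.1 (cB L) (Pi.single y Z)))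
            - LinearMap.adjoint (Qk i.1.1 i.1.2.1 i.1.2.2 i.2.2.le (c₀ L) (cB L) U₀) (((a L i : ℂ)) • toL2B i.1.1 i.1.2.1 (cB L) (Pi.single y Z))) b‖
          ≤ CKΔ L * Real.exp (-(δKΔ L * (Site.tdist (iterBlockOf (i.1.2.2 - i.1.2.1) b.src) (siteShift (sites_eq i.1.1 i.1.2.1 i.1.2.2 i.2.2.le) y.src) : ℝ))) * ‖Z‖)
    (h349 : ∀ (L : ℕ), 1 < L → ∀ (i : Idx L) (U₀ : GaugeField (i.1.1.P i.1.2.2) 0 (Matrix.specialUnitaryGroup (Fin 2) ℂ)), ∀ ρ : ℝ, RegPr i.1.1 i.1.2.1 i.1.2.2 ρ U₀ → ρ ≤ ecap L →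
      ∀ (b : PBond (i.1.1.P i.1.2.2) 0) (Z : Matrix (Fin 2) (Fin 2) ℂ) (bd : PBond (i.1.1.P i.1.2.2) 0),
        ‖(toL2 i.1.1 i.1.2.2 (c₀ L)).symm (DL2 i.1.1 i.1.2.1 i.1.2.2 (c₀ L) U₀ (DstarL2 i.1.1 i.1.2.1 i.1.2.2 (c₀ L) U₀ (toL2 i.1.1 i.1.2.2 (c₀ L) (Pi.single b Z)) - RS i.1.1 i.1.2.1 i.1.2.2 i.2.2.le (c₀ L) (cB L) U₀ (DstarL2 i.1.1 i.1.2.1 i.1.2.2 (c₀ L) U₀ (toL2 i.1.1 i.1.2.2 (c₀ L) (Pi.single b Z))))) bd‖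
          ≤ C349 L * ((L : ℝ) ^ (i.1.2.2 - i.1.2.1))⁻¹ ^ 3 * Real.exp (-(δ349 L * (Site.tdist (iterBlockOf (i.1.2.2 - i.1.2.1) b.src) (iterBlockOf (i.1.2.2 - i.1.2.1) bd.src) : ℝ))) * ‖Z‖)
    (a₀ : ℕ → ℝ)
    (ha₀ : ∀ L : ℕ, 0 < a₀ L)
    (hEng : ∀ (L : ℕ), 1 < L → ∃ γE κD κQ θE eE : ℝ, 0 < γE ∧ 0 ≤ κD ∧ 0 ≤ κQ ∧ 0 ≤ θE ∧ 0 < eE ∧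
      ∀ (F : T3Family), F.L = L → ∀ (n K : ℕ) (hnK : n < K) (e : ℝ) (W : GaugeField (F.P K) 0 (Matrix.specialUnitaryGroup (Fin 2) ℂ)),
        0 < e → e ≤ eE → RegPr F n K e W →
        ∀ y : BondL2K ℂ 3 (periodsT3 F K) (c₀ F.L) W₂,
          γE * ‖y‖ ^ 2 ≤ RCLike.re ⟪y, DeltaEtaSlot F n K (c₀ F.L) W y⟫_ℂ + κD * ‖DstarL2 F n K (c₀ F.L) W y‖ ^ 2
            + κQ * ((a₀ F.L * (c₀ F.L / cB F.L) * ((F.L : ℝ) ^ (K - n)) ^ 3) * ‖Qkc F n K hnK.le (c₀ F.L) (cB F.L) W y‖ ^ 2) + θE * e * ‖y‖ ^ 2)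
    (hB2a : ∀ (L : ℕ), 1 < L → ∀ (CT : ℝ), 0 ≤ CT → ∃ CJ CJ' CJ'' e2 : ℝ, 0 ≤ CJ ∧ 0 ≤ CJ' ∧ 0 ≤ CJ'' ∧ 0 < e2 ∧
        ∀ (F : T3Family), F.L = L → ∀ (n K : ℕ) (hnK : n < K) (e : ℝ), 0 ≤ e → e ≤ e2 →
          ∀ (W : GaugeField (F.P K) 0 (Matrix.specialUnitaryGroup (Fin 2) ℂ)), RegPr F n K e W →
          ∀ (T : PBond (F.P K) (K - n) → (Matrix (Fin 2) (Fin 2) ℂ)ˣ), (∀ c, T c ∈ U1 (Matrix (Fin 2) (Fin 2) ℂ)) →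
            (∀ c : PBond (F.P K) (K - n),
              ‖(T c : Matrix (Fin 2) (Fin 2) ℂ) - ((holT (unitsField (toUField W)) (transl (basePt F n K) (blockBase ((F.P K).L ^ (K - n)) (tlift c.src)))
                  (List.replicate ((F.P K).L ^ (K - n)) (c.dir, true)) : (Matrix (Fin 2) (Fin 2) ℂ)ˣ) : Matrix (Fin 2) (Fin 2) ℂ)‖ ≤ CT * e) →
          ∃ J : (Site (F.P K) (K - n) → Matrix (Fin 2) (Fin 2) ℂ) →ₗ[ℂ] SiteL2K ℂ 3 (periodsT3 F K) (c₀ F.L) W₂,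
            (∀ w, QprimeCombL2 F n K (c₀ F.L) W (J w) = w) ∧
            (∀ w, ‖DL2 F n K (c₀ F.L) W (J w)‖ ^ 2
                ≤ CJ * (c₀ F.L * ((F.L : ℝ) ^ (K - n)) ^ 3 * ∑ c : PBond (F.P K) (K - n), ‖conjR (T c) (w (c.src.shift c.dir)) - w c.src‖ ^ 2)
                  + CJ' * e ^ 2 * (c₀ F.L * ((F.L : ℝ) ^ (K - n)) ^ 3 * ∑ y : Site (F.P K) (K - n), ‖w y‖ ^ 2)) ∧
            (∀ w, ‖J w‖ ^ 2 ≤ CJ'' * (c₀ F.L * ((F.L : ℝ) ^ (K - n)) ^ 3 * ∑ y : Site (F.P K) (K - n), ‖w y‖ ^ 2)))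
    (H : ∀ (F : T3Family) (n K : ℕ) (W : GaugeField (F.P K) 0 (Matrix.specialUnitaryGroup (Fin 2) ℂ)), BondL2K ℂ 3 (periodsT3 F K) (c₀ F.L) W₂ → ℝ)
    (hH0 : ∀ F n K W f, 0 ≤ H F n K W f)
    (hQH1 : ∀ (L : ℕ), 1 < L → ∃ B B' B'' eQ : ℝ, 0 ≤ B ∧ 0 ≤ B' ∧ 0 ≤ B'' ∧ 0 < eQ ∧
      ∀ (F : T3Family), F.L = L → ∀ (n K : ℕ) (hnK : n < K) (e : ℝ) (W : GaugeField (F.P K) 0 (Matrix.specialUnitaryGroup (Fin 2) ℂ)),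
        0 < e → e ≤ eQ → RegPr F n K e W →
        ∀ f : BondL2K ℂ 3 (periodsT3 F K) (c₀ F.L) W₂,
          (c₀ F.L / cB F.L) * ((F.L : ℝ) ^ (K - n)) ^ 3 * ‖Qkc F n K hnK.le (c₀ F.L) (cB F.L) W f‖ ^ 2
            ≤ B * ‖f‖ ^ 2 + B' * H F n K W f + B'' * e * ‖f‖ ^ 2)
    (hPatch : ∀ (L : ℕ), 1 < L → ∃ ν cL cMR cHM : ℝ, 0 ≤ ν ∧ 0 ≤ cL ∧ 0 ≤ cMR ∧ 0 ≤ cHM ∧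
      ∀ s : ℕ, ∃ cΦ cρCu cρN cKCu cKN cMAs cMCu cMe cHCu cHN eP : ℝ,
        0 ≤ cΦ ∧ 0 ≤ cρCu ∧ 0 ≤ cρN ∧ 0 ≤ cKCu ∧ 0 ≤ cKN ∧ 0 ≤ cMAs ∧ 0 ≤ cMCu ∧ 0 ≤ cMe ∧ 0 ≤ cHCu ∧ 0 ≤ cHN ∧ 0 < eP ∧
        ∀ (F : T3Family), F.L = L → ∀ (n K : ℕ) (hnK : n < K) (e : ℝ) (W : GaugeField (F.P K) 0 (Matrix.specialUnitaryGroup (Fin 2) ℂ)),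
          s < F.m + n → 0 < e → e ≤ eP → RegPr F n K e W →
          ∀ y : BondL2K ℂ 3 (periodsT3 F K) (c₀ F.L) W₂,
            ∃ (Z : Site (F.P K) 0 → SiteL2K ℂ 3 (periodsT3 F K) (c₀ F.L) W₂ →ₗ[ℂ] SiteL2K ℂ 3 (periodsT3 F K) (c₀ F.L) W₂)
              (ZE : Site (F.P K) 0 → BondL2K ℂ 3 (periodsT3 F K) (c₀ F.L) W₂ →ₗ[ℂ] BondL2K ℂ 3 (periodsT3 F K) (c₀ F.L) W₂)
              (φ κs : Site (F.P K) 0 → SiteL2K ℂ 3 (periodsT3 F K) (c₀ F.L) W₂) (r : Site (F.P K) 0 → BondL2K ℂ 3 (periodsT3 F K) (c₀ F.L) W₂)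
              (Ni Cui Asi ρi Φi Ki Li Mi Hρi HMi : Site (F.P K) 0 → ℝ),
              (∀ v, ∑ i, Z i v = v) ∧ (∀ f, ∑ i, ZE i f = f) ∧
              (∀ i, Z i (DstarL2 F n K (c₀ F.L) W y) = Z i (covLapSite F n K (c₀ F.L) W (φ i)) + Z i (κs i)) ∧
              (∀ i, ZE i (DL2 F n K (c₀ F.L) W (φ i)) = ZE i y - ZE i (r i)) ∧
              (∀ i, Φi i ≤ cΦ * ((F.L : ℝ) ^ s) ^ 2 * Ni i) ∧
              (∀ i, ρi i ≤ cρCu * Cui i + cρN * e * Ni i) ∧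
              (∀ i, Ki i ≤ cKCu * Cui i + cKN * e * Ni i) ∧
              (∀ i, Li i ≤ cL * ((F.L : ℝ) ^ s)⁻¹ ^ 2 * Ni i) ∧
              (∀ i, Mi i ≤ cMAs * Asi i + cMCu * Cui i + (cMR * ((F.L : ℝ) ^ s)⁻¹ ^ 2 + cMe * e) * Ni i) ∧
              (∀ i, Hρi i ≤ cHCu * Cui i + cHN * e * Ni i) ∧
              (∀ i, HMi i ≤ cHM * ((F.L : ℝ) ^ s)⁻¹ ^ 2 * Ni i) ∧
              (∑ i, Ni i ≤ ν * ‖y‖ ^ 2) ∧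
              (∑ i, Cui i ≤ ν * (RCLike.re ⟪y, DeltaEtaSlot F n K (c₀ F.L) W y⟫_ℂ + 1029 * e * ‖y‖ ^ 2)) ∧
              (∑ i, Asi i ≤ ν * ((c₀ F.L / cB F.L) * ((F.L : ℝ) ^ (K - n)) ^ 3 * ‖Qkc F n K hnK.le (c₀ F.L) (cB F.L) W y‖ ^ 2)) ∧
              (‖∑ i, ZE i (r i)‖ ^ 2 ≤ ν * ∑ i, ρi i) ∧
              (‖∑ i, (DL2 F n K (c₀ F.L) W (Z i (φ i)) - ZE i (DL2 F n K (c₀ F.L) W (φ i)))‖ ^ 2 ≤ ν * ∑ i, Mi i) ∧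
              (H F n K W (∑ i, ZE i (r i)) ≤ ν * ∑ i, Hρi i) ∧
              (H F n K W (∑ i, (DL2 F n K (c₀ F.L) W (Z i (φ i)) - ZE i (DL2 F n K (c₀ F.L) W (φ i)))) ≤ ν * ∑ i, HMi i) ∧
              (‖∑ i, (covLapSite F n K (c₀ F.L) W (Z i (φ i)) - Z i (covLapSite F n K (c₀ F.L) W (φ i)))‖ ^ 2 ≤ ν * ∑ i, Li i) ∧
              (‖∑ i, Z i (κs i)‖ ^ 2 ≤ ν * ∑ i, Ki i) ∧
              (‖∑ i, Z i (φ i)‖ ^ 2 ≤ ν * ∑ i, Φi i))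
    (hMc : ∀ (L : ℕ), 1 < L → ∀ (B₁' : ℝ), 0 < B₁' → ∃ eC A B B' : ℝ, 0 < eC ∧ 0 ≤ A ∧ 0 ≤ B ∧ 0 ≤ B' ∧
      ∀ (F : T3Family), F.L = L → ∀ (n K : ℕ) (hnK : n < K) (e : ℝ) (V : GaugeField (F.P n) 0 (Matrix.specialUnitaryGroup (Fin 2) ℂ))
        (W : GaugeField (F.P K) 0 (Matrix.specialUnitaryGroup (Fin 2) ℂ)) (X : PBond (F.P K) 0 → Matrix (Fin 2) (Fin 2) ℂ),
        0 < e → e ≤ eC → W ∈ regFibrePr F n K hnK.le e V →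
        (∀ γ : ℝ → GaugeField (F.P K) 0 (Matrix.specialUnitaryGroup (Fin 2) ℂ), γ 0 = W → (∀ t, γ t ∈ fibre F ℰp n K hnK.le V) →
          (∀ b, DifferentiableAt ℝ (fun t => ((γ t b : Matrix.specialUnitaryGroup (Fin 2) ℂ) : Matrix (Fin 2) (Fin 2) ℂ)) 0) →
            deriv (fun t => wilsonAction4 (γ t)) 0 = 0) →
        In19 F n K (2 * B₁' * e) W (expHermField X) X → AvgCondPrint F n K hnK.le V W X → IsLandauPrint F n K W X →
          ∀ l : ℕ, l < K - n →
            ∑ z : Site (F.P K) l, ∑ κ : Fin (F.P K).d,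
              ‖((tildIter (F.P K).L (pull (bgUnits F K W) (basePt F n K)) (pull (fun b => expUnit (Complex.I • X b)) (basePt F n K)) l
              (fun μ => ((z μ).val : ℤ)) κ : (Matrix (Fin 2) (Fin 2) ℂ)ˣ) : Matrix (Fin 2) (Fin 2) ℂ) - 1‖ ^ 2
              ≤ A * (∑ b : PBond (F.P K) 0, ‖X b‖ ^ 2) * ((F.L : ℝ) ^ l)⁻¹
                + (B * ((∑ p : Plaq (F.P K) 0, ‖((Complex.I • X ⟨p.src, p.μ⟩) + ((W ⟨p.src, p.μ⟩ : Matrix (Fin 2) (Fin 2) ℂ) * (Complex.I • X ⟨p.src.shift p.μ, p.ν⟩) * star (W ⟨p.src, p.μ⟩ : Matrix (Fin 2) (Fin 2) ℂ))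
            - (((W ⟨p.src, p.μ⟩ * W ⟨p.src.shift p.μ, p.ν⟩ * (W ⟨p.src.shift p.ν, p.μ⟩)⁻¹ : Matrix.specialUnitaryGroup (Fin 2) ℂ) : Matrix (Fin 2) (Fin 2) ℂ) * (Complex.I • X ⟨p.src.shift p.ν, p.μ⟩) * star ((W ⟨p.src, p.μ⟩ * W ⟨p.src.shift p.μ, p.ν⟩ * (W ⟨p.src.shift p.ν, p.μ⟩)⁻¹ : Matrix.specialUnitaryGroup (Fin 2) ℂ) : Matrix (Fin 2) (Fin 2) ℂ))
            - (((GaugeField.plaqHol W p : Matrix.specialUnitaryGroup (Fin 2) ℂ) : Matrix (Fin 2) (Fin 2) ℂ) * (Complex.I • X ⟨p.src, p.ν⟩) * star ((GaugeField.plaqHol W p : Matrix.specialUnitaryGroup (Fin 2) ℂ) : Matrix (Fin 2) (Fin 2) ℂ)))‖ ^ 2) + (∑ x : Site (F.P K) 0, ∑ j : Fin 2, ∑ k : Fin 2,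
              ‖(divB (torusT (F.P K) 0) (fun κ z => unitsField (toUField W) ⟨z, κ⟩) (fun κ z => Complex.I • X ⟨z, κ⟩) x) j k‖ ^ 2))
                  + B' * (((F.L : ℝ) ^ (K - n)) ^ 2)⁻¹ * (∑ b : PBond (F.P K) 0, ‖X b‖ ^ 2)) * (F.L : ℝ) ^ l)
    (hMc₂ : ∀ (L : ℕ), 1 < L → ∀ (B₁' : ℝ), 0 < B₁' → ∃ e₂ A₂ B₂ B₂' : ℝ, 0 < e₂ ∧ 0 ≤ A₂ ∧ 0 ≤ B₂ ∧ 0 ≤ B₂' ∧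
      ∀ (F : T3Family), F.L = L → ∀ (n K : ℕ) (hnK : n < K) (e : ℝ) (V : GaugeField (F.P n) 0 (Matrix.specialUnitaryGroup (Fin 2) ℂ))
        (W : GaugeField (F.P K) 0 (Matrix.specialUnitaryGroup (Fin 2) ℂ)) (X : PBond (F.P K) 0 → Matrix (Fin 2) (Fin 2) ℂ),
        0 < e → e ≤ e₂ → W ∈ regFibrePr F n K hnK.le e V →
        (∀ γ : ℝ → GaugeField (F.P K) 0 (Matrix.specialUnitaryGroup (Fin 2) ℂ), γ 0 = W → (∀ t, γ t ∈ fibre F ℰp n K hnK.le V) →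
          (∀ b, DifferentiableAt ℝ (fun t => ((γ t b : Matrix.specialUnitaryGroup (Fin 2) ℂ) : Matrix (Fin 2) (Fin 2) ℂ)) 0) →
            deriv (fun t => wilsonAction4 (γ t)) 0 = 0) →
        In19 F n K (2 * B₁' * e) W (expHermField X) X → AvgCondPrint F n K hnK.le V W X → IsLandauPrint F n K W X →
          ∀ l : ℕ, l < K - n →
            ∑ z : Site (F.P K) l, ∑ κ : Fin (F.P K).d,
              ‖((tildIter (F.P K).L (pull (bgUnits F K W) (basePt F n K)) (pull (fun b => expUnit (Complex.I • X b)) (basePt F n K)) l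
              (fun μ => ((z μ).val : ℤ)) κ : (Matrix (Fin 2) (Fin 2) ℂ)ˣ) : Matrix (Fin 2) (Fin 2) ℂ) - 1
            - (fderiv ℂ (fun A' : PBond (F.P K) 0 → Matrix (Fin 2) (Fin 2) ℂ =>
                ((tildIter (F.P K).L (pull (bgUnits F K W) (basePt F n K)) (pull (fun b => expUnit (A' b)) (basePt F n K)) l (fun μ => ((z μ).val : ℤ)) κ :
                  (Matrix (Fin 2) (Fin 2) ℂ)ˣ) : Matrix (Fin 2) (Fin 2) ℂ)) 0) (fun b => Complex.I • X b)‖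
              ≤ A₂ * (∑ b : PBond (F.P K) 0, ‖X b‖ ^ 2) * ((F.L : ℝ) ^ l)⁻¹
                + (B₂ * ((∑ p : Plaq (F.P K) 0, ‖((Complex.I • X ⟨p.src, p.μ⟩) + ((W ⟨p.src, p.μ⟩ : Matrix (Fin 2) (Fin 2) ℂ) * (Complex.I • X ⟨p.src.shift p.μ, p.ν⟩) * star (W ⟨p.src, p.μ⟩ : Matrix (Fin 2) (Fin 2) ℂ))
            - (((W ⟨p.src, p.μ⟩ * W ⟨p.src.shift p.μ, p.ν⟩ * (W ⟨p.src.shift p.ν, p.μ⟩)⁻¹ : Matrix.specialUnitaryGroup (Fin 2) ℂ) : Matrix (Fin 2) (Fin 2) ℂ) * (Complex.I • X ⟨p.src.shift p.ν, p.μ⟩) * star ((W ⟨p.src, p.μ⟩ * W ⟨p.src.shift p.μ, p.ν⟩ * (W ⟨p.src.shift p.ν, p.μ⟩)⁻¹ : Matrix.specialUnitaryGroup (Fin 2) ℂ) : Matrix (Fin 2) (Fin 2) ℂ))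
            - (((GaugeField.plaqHol W p : Matrix.specialUnitaryGroup (Fin 2) ℂ) : Matrix (Fin 2) (Fin 2) ℂ) * (Complex.I • X ⟨p.src, p.ν⟩) * star ((GaugeField.plaqHol W p : Matrix.specialUnitaryGroup (Fin 2) ℂ) : Matrix (Fin 2) (Fin 2) ℂ)))‖ ^ 2) + (∑ x : Site (F.P K) 0, ∑ j : Fin 2, ∑ k : Fin 2,
              ‖(divB (torusT (F.P K) 0) (fun κ z => unitsField (toUField W) ⟨z, κ⟩) (fun κ z => Complex.I • X ⟨z, κ⟩) x) j k‖ ^ 2))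
                  + B₂' * (((F.L : ℝ) ^ (K - n)) ^ 2)⁻¹ * (∑ b : PBond (F.P K) 0, ‖X b‖ ^ 2)) * (F.L : ℝ) ^ l)
    (hN2s : ∀ (L : ℕ), 1 < L → ∀ (B₁' : ℝ), 0 < B₁' → ∃ e₃ A₃ B₃ B₃' : ℝ, 0 < e₃ ∧ 0 ≤ A₃ ∧ 0 ≤ B₃ ∧ 0 ≤ B₃' ∧
      ∀ (F : T3Family), F.L = L → ∀ (n K : ℕ) (hnK : n < K) (e : ℝ) (V : GaugeField (F.P n) 0 (Matrix.specialUnitaryGroup (Fin 2) ℂ))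
        (W : GaugeField (F.P K) 0 (Matrix.specialUnitaryGroup (Fin 2) ℂ)) (X : PBond (F.P K) 0 → Matrix (Fin 2) (Fin 2) ℂ),
        0 < e → e ≤ e₃ → W ∈ regFibrePr F n K hnK.le e V →
        (∀ γ : ℝ → GaugeField (F.P K) 0 (Matrix.specialUnitaryGroup (Fin 2) ℂ), γ 0 = W → (∀ t, γ t ∈ fibre F ℰp n K hnK.le V) →
          (∀ b, DifferentiableAt ℝ (fun t => ((γ t b : Matrix.specialUnitaryGroup (Fin 2) ℂ) : Matrix (Fin 2) (Fin 2) ℂ)) 0) →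
            deriv (fun t => wilsonAction4 (γ t)) 0 = 0) →
        In19 F n K (2 * B₁' * e) W (expHermField X) X → AvgCondPrint F n K hnK.le V W X → IsLandauPrint F n K W X →
          ∀ l : ℕ, l < K - n →
            ∑ b : PBond (F.P K) l,
              ‖pertVar (Averaging.iter (fun i => blockAvg (P := (F.P K)) (j := i) (expMeanLogSU (n := Fin 2))) l W)
                (Averaging.iter (fun i => blockAvg (P := (F.P K)) (j := i) (expMeanLogSU (n := Fin 2))) l (emb15 W (expHermField X))) b
              - fderiv ℂ (fun t : PBond (F.P K) 0 → Matrix (Fin 2) (Fin 2) ℂ =>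
                  ((emlIterU l (fun b' => expUnit (t b') * bgUnits F K W b') b : (Matrix (Fin 2) (Fin 2) ℂ)ˣ) : Matrix (Fin 2) (Fin 2) ℂ)) 0 (fun b' => Complex.I • X b')
                * star ((Averaging.iter (fun i => blockAvg (P := (F.P K)) (j := i) (expMeanLogSU (n := Fin 2))) l W b : Matrix.specialUnitaryGroup (Fin 2) ℂ) : Matrix (Fin 2) (Fin 2) ℂ)‖
              ≤ A₃ * (∑ b : PBond (F.P K) 0, ‖X b‖ ^ 2) * ((F.L : ℝ) ^ l)⁻¹
                + (B₃ * ((∑ p : Plaq (F.P K) 0, ‖((Complex.I • X ⟨p.src, p.μ⟩) + ((W ⟨p.src, p.μ⟩ : Matrix (Fin 2) (Fin 2) ℂ) * (Complex.I • X ⟨p.src.shift p.μ, p.ν⟩) * star (W ⟨p.src, p.μ⟩ : Matrix (Fin 2) (Fin 2) ℂ))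
            - (((W ⟨p.src, p.μ⟩ * W ⟨p.src.shift p.μ, p.ν⟩ * (W ⟨p.src.shift p.ν, p.μ⟩)⁻¹ : Matrix.specialUnitaryGroup (Fin 2) ℂ) : Matrix (Fin 2) (Fin 2) ℂ) * (Complex.I • X ⟨p.src.shift p.ν, p.μ⟩) * star ((W ⟨p.src, p.μ⟩ * W ⟨p.src.shift p.μ, p.ν⟩ * (W ⟨p.src.shift p.ν, p.μ⟩)⁻¹ : Matrix.specialUnitaryGroup (Fin 2) ℂ) : Matrix (Fin 2) (Fin 2) ℂ))
            - (((GaugeField.plaqHol W p : Matrix.specialUnitaryGroup (Fin 2) ℂ) : Matrix (Fin 2) (Fin 2) ℂ) * (Complex.I • X ⟨p.src, p.ν⟩) * star ((GaugeField.plaqHol W p : Matrix.specialUnitaryGroup (Fin 2) ℂ) : Matrix (Fin 2) (Fin 2) ℂ)))‖ ^ 2) + (∑ x : Site (F.P K) 0, ∑ j : Fin 2, ∑ k : Fin 2,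
              ‖(divB (torusT (F.P K) 0) (fun κ z => unitsField (toUField W) ⟨z, κ⟩) (fun κ z => Complex.I • X ⟨z, κ⟩) x) j k‖ ^ 2))
                  + B₃' * (((F.L : ℝ) ^ (K - n)) ^ 2)⁻¹ * (∑ b : PBond (F.P K) 0, ‖X b‖ ^ 2)) * (F.L : ℝ) ^ l)
    (hThm2S : ∀ (L : ℕ), 1 < L → ∃ B₁ c₁ : ℝ, 0 < B₁ ∧ 0 < c₁ ∧ ∀ (F : T3Family), F.L = L → ∀ (n K : ℕ), n < K →
      ∃ (β₀ B₂ : ℝ) (len : B7Prop1Explicit.Site (F.P K).d → ℝ),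
        Thm2SetupSUAt (F.P K) 2 (K - n) (eta F n K) β₀ B₁ B₂ c₁ len (fun _ => True)) :
    ∀ (L : ℕ), 1 < L → ∀ (B₃ : ℝ), 4 < B₃ → ∃ a₁' O₁ : ℝ, 0 < a₁' ∧ 1 ≤ O₁ ∧
    ∀ (F : T3Family), F.L = L → ∀ (n K : ℕ) (hnK : n < K) (ε₁ : ℝ), 0 < ε₁ →
      ∀ V : GaugeField (F.P n) 0 (Matrix.specialUnitaryGroup (Fin 2) ℂ), PlaqSmall ε₁ V →
        ∀ U₀ : GaugeField (F.P K) 0 (Matrix.specialUnitaryGroup (Fin 2) ℂ), RegPr F n K ((L : ℝ) ^ 3 * B₃ * ε₁) U₀ → U₀ ∈ fibre F ℰp n K hnK.le V →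
          ε₁ ≤ a₁' → ∃ U ∈ regFibrePr F n K hnK.le (O₁ * (L : ℝ) ^ 3 * B₃ * ε₁) V,
            IsMinOn (fun W : GaugeField (F.P K) 0 (Matrix.specialUnitaryGroup (Fin 2) ℂ) => wilsonAction4 W)
              (regFibrePr F n K hnK.le (O₁ * (L : ℝ) ^ 3 * B₃ * ε₁) V) U := by
  obtain ⟨ef, α, a₃, r, ε', εC, C₄, M, hef, hα, ha₃, hr, hC₄, hM, hWQ, hWe, hWε, hMe, hw137, hq47, hR6, hrε2, hεC, hdomC, hselfC, hcontrC,
      hrα, hr4, hr16, hqΘ, hR16, hWe2, hWε2, hWe'', hWε'', hαcap, hC4, hMdoor⟩ :=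
    numericWindows_inhabited_family_S31C B₀ p139 CH δH CΔ δΔ C349 δ349 CKπ δKπ CKΔ δKΔ CC δC hB₀ hCH hδH hCΔ hδΔ hp139 hC349 hδ349 hCKπ hδKπ hCKΔ hδKΔ hCC hδC ecap hecap
  exact stubEX_of_chartPiecesTwS33L B₀ C₄ a₃ α r M hB₀ hC₄ ha₃ hα hr hM c₀ cB a ha hWQ (fun L hL i U₀ hreg => hPos₁ L hL i U₀ (α L) hreg (hαcap L hL))
    (fun L hL i U₀ hreg => hPosπ L hL i U₀ (α L) hreg (hαcap L hL)) (fun L hL i U₀ hreg => hPosΔ L hL i U₀ (α L) hreg (hαcap L hL)) εC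
    (fun L hL i ρ U₀ hreg hρ => norm_G L hL i ρ U₀ hreg (hρ.trans (hαcap L hL))) CH δH CΔ δΔ hCH hδH hCΔ hδΔ (fun L hL i U₀ hreg => h133 L hL i U₀ (α L) hreg (hαcap L hL))
    (fun L hL i U₀ hreg => h88 L hL i U₀ (α L) hreg (hαcap L hL)) (fun L hL i ρ U₀ hreg hρ => norm_H₁ L hL i ρ U₀ hreg (hρ.trans (hαcap L hL)))
    (fun L hL i ρ U₀ hreg hρ => norm_Hπ L hL i ρ U₀ hreg (hρ.trans (hαcap L hL))) ef hef hWe hWε hWe'' hWε'' hMe hw137 ε' hq47 hR6 hrε2 hεC hdomC hselfC hcontrC hrα hr4 hr16 p139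
    hp139 C349 δ349 CKπ δKπ CKΔ δKΔ CC δC hC349 hδ349 hCKπ hδKπ hCKΔ hδKΔ hCC hδC hqΘ hR16 hC4 (fun L hL i U₀ hreg => h137kπ L hL i U₀ (α L) hreg (hαcap L hL))
    (fun L hL i U₀ hreg => hPcol L hL i U₀ (α L) hreg (hαcap L hL)) (fun L hL i U₀ hreg => hCk L hL i U₀ (α L) hreg (hαcap L hL))
    (fun L hL i U₀ hreg => h137kΔ L hL i U₀ (α L) hreg (hαcap L hL)) (fun L hL i U₀ hreg => h349 L hL i U₀ (α L) hreg (hαcap L hL)) hMdoor hWe2 hWε2 a₀ ha₀ hEng hB2a H hH0 hQH1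
    hPatch hMc hMc₂ hN2s hThm2S

end Summit.QuantumFields.YangMills.Theorems.Prop7StubEXNumeralsOut

end
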